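import Literature.Computability.Cryptography.ChenQuantumLWEEq41Exact

/-!
# Chen (2024), Step 9 performed honestly: the exact output law of (9.e)–(9.h)

REPRODUCTION of a WITHDRAWN preprint, formalised for the record — NOT a live algorithmic claim and NOT
progress on any summit: Yilei Chen, *Quantum Algorithms for Lattice Problems*, IACR ePrint 2024/555,
versions of April 2024, withdrawn by the author's note of 2024-04-18/19 ("Step 9 of the algorithm
contains a bug, which I don't know how to fix … the quantum algorithm in Section 3 is not correct";
tree key `ChenQuantumLattice2024`; the tree key `Chen2024` is an unrelated paper).  HONEST FRAMING: the
value of this file is a kernel-checked closed form for the output distribution of Step 9 when its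
OPERATIONS are carried out as specified — a precise negative result about a withdrawn algorithm (the
run ends in a sample that is useless for Lemma 3.8), nothing more.

The earlier files of this bundle treat the processing of register `0` in (9.e)–(9.g) as an ARBITRARY
kernel `K` (`Shape.processed K`) and prove `Pr[(41)] = Pr[p₁ ∣ u₀]/Q ≤ 1/Q` for all of them
(`ChenQuantumLWEBornRule`, `ChenQuantumLWEEq41Exact`); Chen's displayed state `|φ8.g⟩` is refuted
(`ChenQuantumLWEDisplayRefutation`), so "the paper's `K`" cannot be read off the display.  What CAN be
modelled is the sequence of OPERATIONS the paper prescribes (pp. 37–38), each of which is a legitimate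
register operation:

* (9.e) Lemma 2.17 as PROVED (adjoin a uniform high digit `h ∈ ℤ_Q` to register `0`:
  `|y⟩ ↦ Σ_h |y + hN⟩ ∈ ℂ[ℤ_{QN}]`, `domainExtFirst`), followed by
* (9.f) "divide the first coordinate by `Q = p₂⋯p_κ`" (the basis relabelling `|z⟩ ↦ |z/Q⟩`, defined on
  the span of the `|z⟩` with `Q ∣ z`, which contains the extended state because `Q ∣ 2D²Qk` and `Q ∣ N`);
  on amplitude functions the composite (9.e)∘(9.f) is the pull-back along multiplication by `Q`,
  `x ↦ ψ(Q·x mod N)` (`Shape.extDivKernel`, `Shape.extDivKernel_apply_cons`);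
* (9.g) the phase kickback `e(+j²/P)` with `j` READ OFF register `0` as Chen prescribes ("`j` is
  computable from `D²·2j mod D²p₁…p_κ`": `j := (x/D²)·2⁻¹ mod P`, `Shape.jOf`, `Shape.kickPhase`);
* (9.h) `QFT_{ℤ_N^{n+1}}` and measurement (`qft`, as in the rest of the bundle).

The composite of (9.e)–(9.g) is ONE kernel on register `0`, `Shape.honestKernel`, so every theorem of
`ChenQuantumLWESecretIndependence` / `ChenQuantumLWEEq41Exact` applies to it.  This file computes its
public head weight in closed form and reads off the law:

* `Shape.honestKernel_headVec` — register `0` after (9.e)–(9.g) holds `D²(2k + p₁h) mod N`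
  (`k ∈ ℤ_{p₁}` the head digit of `j`, `h ∈ ℤ_Q` the FRESH digit adjoined by Lemma 2.17) with amplitude
  `e(-ᾱQk²/P)·e(ȷ̃²/P)`, `ȷ̃ = (2k + p₁h)/2 mod P`: the kickback cancels the `p₁`-part of the chirp
  (`ȷ̃ ≡ k ≡ j (mod p₁)`) but NOT its `Q`-part, because `ȷ̃ mod Q` is the fresh digit `h`, not `j mod Q`
  (which sits in registers `1..n`).
* `Shape.headWeight_honest` — `headWeight D p₁ Q honestKernel u₀ = p₁²·Q·[p₁ ∣ u₀]`: the coordinate-`0`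
  Fourier sum factors (CRT for `ψ_P`, `stdAddChar_crt_split`) into a complete character sum modulo `p₁`
  (`= p₁·[p₁ ∣ u₀]`) times a quadratic Gauss sum modulo `Q` with unit leading coefficient (`|·|² = Q`,
  Korobov 1992 Ch. I §3 Thm 3, `Literature.NumberTheory.GaussSums.norm_sq_sum_stdAddChar_quadratic`).
* `Shape.born_weight_honest`, `Shape.prob_outcome_honest` — the honest run's output law:
  `Pr[u = (u₀ | u′)] = p₁·[p₁ ∣ u₀] / N^{n+1}`, i.e. `u` is UNIFORM on `{u ∈ ℤ_N^{n+1} : p₁ ∣ u₀}`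
  (`REPAIR-CENSUS.md` T2 / `STEPS.md` §4.4(d) of the bundle, previously a hand computation and a toy
  table): register `0` is a uniformly random multiple of `p₁`, registers `1..n` are uniform and independent.
* `Shape.prob_head_dvd_honest`, `Shape.prob_eq41_honest` — `Pr[p₁ ∣ u₀] = 1` and therefore
  `Pr[(41)] = 1/Q` EXACTLY: the honest run ATTAINS the universal bound `1/Q` of
  `ChenQuantumLWEBornRule.prob_eq41_le` (`Shape.prob_eq41_eq_inv_iff`), and Lemma 3.8 ("(41) with
  certainty") fails by the factor `Q = p₂⋯p_κ`.

Not here: any claim about Steps 1–8 (Claims 3.12/3.14 are restated, not re-verified, in the bundle), any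
repair of Step 9, any complexity statement.
-/

namespace Literature.Computability.Cryptography.Chen2024

open scoped BigOperators

/-! ### Two character-sum identities -/

/-- **CRT factorisation of the standard character of `ℤ_{p₁Q}`** along a Bezout pair
`α·Q + β·p₁ = 1`: `ψ_{p₁Q}(y) = ψ_{p₁}(α·y) · ψ_Q(β·y)` (`e(m/(p₁Q)) = e(αm/p₁)·e(βm/Q)`). [folklore] -/
theorem stdAddChar_crt_split (P p₁ Q : ℕ) [NeZero P] [NeZero p₁] [NeZero Q] (hP : P = p₁ * Q)
    (α β : ℤ) (hbez : α * Q + β * p₁ = 1) (y : ZMod P) :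
    ZMod.stdAddChar y
      = ZMod.stdAddChar ((α : ZMod p₁) * ZMod.castHom (⟨Q, hP⟩ : p₁ ∣ P) (ZMod p₁) y)
        * ZMod.stdAddChar ((β : ZMod Q) * ZMod.castHom (⟨p₁, hP.trans (Nat.mul_comm _ _)⟩ : Q ∣ P)
            (ZMod Q) y) := by
  obtain ⟨m, rfl⟩ : ∃ m : ℤ, (m : ZMod P) = y :=
    ⟨(y.val : ℤ), by rw [Int.cast_natCast, ZMod.natCast_zmod_val]⟩
  simp only [map_intCast]
  have h1 := congrArg (Int.cast : ℤ → ZMod P) hbez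
  push_cast at h1
  have hsplit : ((m : ℤ) : ZMod P)
      = ((((Q : ℕ) : ℤ) * (α * m) : ℤ) : ZMod P) + ((((p₁ : ℕ) : ℤ) * (β * m) : ℤ) : ZMod P) := by
    push_cast
    linear_combination (-(m : ZMod P)) * h1
  have hPZ₁ : ((P : ℕ) : ℤ) = ((Q : ℕ) : ℤ) * (p₁ : ℕ) := by rw [hP]; push_cast; ring
  have hPZ₂ : ((P : ℕ) : ℤ) = ((p₁ : ℕ) : ℤ) * (Q : ℕ) := by rw [hP]; push_cast; ring
  rw [hsplit, AddChar.map_add_eq_mul, stdAddChar_intCast_mul P p₁ ((Q : ℕ) : ℤ) (α * m) hPZ₁,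
    stdAddChar_intCast_mul P Q ((p₁ : ℕ) : ℤ) (β * m) hPZ₂]
  push_cast
  rfl

/-- An affine change of variables with unit slope does not change a complete sum over `ℤ_Q`. [folklore] -/
theorem sum_affine_eq {Q : ℕ} [NeZero Q] (a c : ZMod Q) (hc : IsUnit c) (f : ZMod Q → ℂ) :
    ∑ t : ZMod Q, f (a + c * t) = ∑ s : ZMod Q, f s := by
  obtain ⟨u, rfl⟩ := hc
  exact Fintype.sum_equiv (u.mulLeft.trans (Equiv.addLeft a)) (fun t => f (a + (u : ZMod Q) * t)) f
    (fun t => rfl)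

namespace Shape

variable (S : Shape)

/-! ### Arithmetic of the admissible shape used below -/

/-- Bezout in `ℤ_{p₁}`: `ᾱ·Q = 1` (`ᾱ = Nat.gcdB p₁ Q`). [folklore] -/
theorem Admissible.gcdB_mul_Q {S : Shape} (h : S.Admissible) :
    ((Nat.gcdB S.p₁ S.Q : ℤ) : ZMod S.p₁) * ((S.Q : ℕ) : ZMod S.p₁) = 1 := by
  have hbz := congrArg (fun z : ℤ => (z : ZMod S.p₁)) (bezout_of_coprime h.cop_pQ)
  simp only [Int.cast_add, Int.cast_mul, Int.cast_natCast, ZMod.natCast_self, mul_zero, add_zero,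
    Int.cast_one] at hbz
  exact hbz

/-- Bezout in `ℤ_Q`: `β·p₁ = 1` (`β = Nat.gcdA p₁ Q`). [folklore] -/
theorem Admissible.gcdA_mul_p₁ {S : Shape} (h : S.Admissible) :
    ((Nat.gcdA S.p₁ S.Q : ℤ) : ZMod S.Q) * ((S.p₁ : ℕ) : ZMod S.Q) = 1 := by
  have hbz := congrArg (fun z : ℤ => (z : ZMod S.Q)) (bezout_of_coprime h.cop_pQ)
  simp only [Int.cast_add, Int.cast_mul, Int.cast_natCast, ZMod.natCast_self, mul_zero, zero_add,
    Int.cast_one] at hbz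
  exact hbz

/-- `(P + 1)/2`: the inverse of `2` modulo the odd number `P`, as the natural number Chen's classical
read-out "compute `j` from `2j mod P`" multiplies by. [cite: ChenQuantumLattice2024, §3.5.9 (9.g) p. 38] -/
def halfP : ℕ := ((S.P : ℕ) + 1) / 2

/-- `2 · halfP = P + 1` (`P` is odd under Cond. C.3). [cite: ChenQuantumLattice2024, Cond. C.3 p. 18] -/
theorem two_mul_halfP (h : S.Admissible) : 2 * S.halfP = (S.P : ℕ) + 1 :=
  Nat.two_mul_div_two_of_even (show Odd (S.P : ℕ) from h.odd_P).add_one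

/-- `2 · halfP = 1` in `ℤ_m` for every `m ∣ P` (used with `m = p₁` and `m = Q`). [folklore] -/
theorem two_mul_halfP_cast (h : S.Admissible) {m : ℕ} (hm : m ∣ (S.P : ℕ)) :
    (2 : ZMod m) * ((S.halfP : ℕ) : ZMod m) = 1 := by
  have h1 : ((2 * S.halfP : ℕ) : ZMod m) = (((S.P : ℕ) + 1 : ℕ) : ZMod m) := by
    rw [S.two_mul_halfP h]
  push_cast at h1
  rwa [(ZMod.natCast_eq_zero_iff _ _).2 hm, zero_add] at h1

/-- `p₁ ∣ P`. [folklore] -/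
theorem p₁_dvd_P : (S.p₁ : ℕ) ∣ (S.P : ℕ) := ⟨S.Q, rfl⟩

/-! ### The honest operations (9.e)–(9.g) as one kernel on register 0 -/

/-- **(9.e) + (9.f) performed honestly.**  Lemma 2.17 as proved adjoins a uniform digit `h ∈ ℤ_Q`
(`|y⟩ ↦ Σ_h |y + hN⟩ ∈ ℂ[ℤ_{QN}]`); "divide the first coordinate by `Q`" relabels `|z⟩ ↦ |z/Q⟩` on the span
of the `|z⟩` with `Q ∣ z` (which contains the extended state: `Q ∣ N` and `Q ∣ 2D²Qk`).  On amplitude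
functions of register `0` the composite is the pull-back along multiplication by `Q`: the new amplitude at
`x ∈ ℤ_N` is the old amplitude at `Q·x mod N` (`extDivKernel_apply_cons`).  As a kernel (`K x y`: new value
`x`, old value `y`): `[Q·x = y]`. [cite: ChenQuantumLattice2024, Lemma 2.17 p. 14; §3.5.9 (9.e)–(9.f) p. 37] -/
noncomputable def extDivKernel (x y : ZMod S.N) : ℂ :=
  if ((S.Q : ℕ) : ZMod S.N) * x = y then 1 else 0

/-- Chen's classical read-out of `j` from register `0` after (9.f) (p. 38: "`j` is computable from
`D²·2j mod D²p₁…p_κ`"): content `x = D²·(2j mod P)` ↦ `(x / D²)·2⁻¹ mod P`.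
[cite: ChenQuantumLattice2024, §3.5.9 (9.g) p. 38] -/
def jOf (x : ZMod S.N) : ZMod S.P :=
  (((x.val / ((S.D : ℕ) * S.D)) * S.halfP : ℕ) : ZMod S.P)

/-- **(9.g) performed honestly**: the phase kickback `e(+(2D·j)²/(2M)) = e(j²/P)` (Lemma 2.13) by the
read-out `j = jOf x` of register `0`. [cite: ChenQuantumLattice2024, Lemma 2.13 p. 13; §3.5.9 (9.g) p. 38] -/
noncomputable def kickPhase (x : ZMod S.N) : ℂ :=
  e ((((S.jOf x) ^ 2).val : ℚ) / S.P)

/-- **Steps (9.e)–(9.g) as ONE kernel on register `0`** (extend-and-divide, then kick):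
`honestKernel x y = [Q·x = y] · e(jOf(x)²/P)`; `Shape.processed honestKernel` is the state Chen's
operations actually hand to the final `QFT` (9.h). [cite: ChenQuantumLattice2024, §3.5.9 (9.e)–(9.g) pp. 37–38] -/
noncomputable def honestKernel (x y : ZMod S.N) : ℂ :=
  S.extDivKernel x y * S.kickPhase x

/-- `extDivKernel` IS Lemma 2.17 (`domainExtFirst Q`) followed by the division: applying it to register `0`
of any state `ψ` evaluates the domain-extended state at the point `Q·x ∈ ℤ_{QN}` whose quotient by `Q` is
`x`. [cite: ChenQuantumLattice2024, Lemma 2.17 p. 14; §3.5.9 (9.e)–(9.f) p. 37] -/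
theorem extDivKernel_apply_cons (ψ : Ket (S.n + 1) S.N) (x : ZMod S.N) (z' : Fin S.n → ZMod S.N) :
    ∑ y, S.extDivKernel x y * ψ (Fin.cons y z')
      = domainExtFirst (S.Q : ℕ) ψ ((((S.Q : ℕ) * x.val : ℕ) : ZMod ((S.Q : ℕ) * S.N)), z') := by
  simp only [extDivKernel, ite_mul, one_mul, zero_mul, Finset.sum_ite_eq, Finset.mem_univ, if_true,
    domainExtFirst, map_natCast]
  rw [show ((((S.Q : ℕ) * x.val : ℕ)) : ZMod S.N) = ((S.Q : ℕ) : ZMod S.N) * x by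
    push_cast [ZMod.natCast_zmod_val]; rfl]

/-- The points register `0` can hold after (9.e)–(9.f): `x_{k,h} = D²(2k + p₁h) mod N`
(`k` the head digit, `h` the adjoined digit). [cite: ChenQuantumLattice2024, §3.5.9 p. 37] -/
def xkh (k hh : ℕ) : ZMod S.N :=
  (((S.D : ℕ) * S.D * (2 * k + S.p₁ * hh) : ℕ) : ZMod S.N)

/-- `Q · x_{k,h} = 2D²Qk (mod N)`: every `x_{k,h}` lies over the `k`-th point of `|A⟩`. [folklore] -/
theorem Q_mul_xkh (k hh : ℕ) :
    ((S.Q : ℕ) : ZMod S.N) * S.xkh k hh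
      = ((2 * (S.D : ℤ) ^ 2 * (k : ℤ) * (S.Q : ℤ) : ℤ) : ZMod S.N) := by
  have hNn : ((S.D : ℕ) * S.D * (S.p₁ * S.Q) : ℕ) = (S.N : ℕ) := rfl
  have hN : (((S.D : ℕ) * S.D * (S.p₁ * S.Q) : ℕ) : ZMod S.N) = 0 := by
    rw [hNn]
    exact ZMod.natCast_self _
  have h1 : ((S.Q : ℕ) : ZMod S.N) * S.xkh k hh
      = ((2 * (S.D : ℤ) ^ 2 * (k : ℤ) * (S.Q : ℤ) : ℤ) : ZMod S.N)
        + (hh : ZMod S.N) * (((S.D : ℕ) * S.D * (S.p₁ * S.Q) : ℕ) : ZMod S.N) := by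
    unfold xkh
    push_cast
    ring
  rw [h1, hN, mul_zero, add_zero]

/-- The fibre of (9.e)–(9.f) over the `k`-th point of `|A⟩`: `Q·x₀ = 2D²Qk (mod N)` forces
`x₀ = x_{k,h}` for some `h < Q`. [folklore] -/
theorem exists_xkh_of_Q_mul_eq (k : ℕ) (x₀ : ZMod S.N)
    (hx : ((S.Q : ℕ) : ZMod S.N) * x₀ = ((2 * (S.D : ℤ) ^ 2 * (k : ℤ) * (S.Q : ℤ) : ℤ) : ZMod S.N)) :
    ∃ hh ∈ Finset.range (S.Q : ℕ), x₀ = S.xkh k hh := by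
  have hNZ : ((S.N : ℕ) : ℤ) = (S.D : ℤ) ^ 2 * (S.p₁ : ℤ) * (S.Q : ℤ) := by
    show ((((S.D * S.D * (S.p₁ * S.Q) : ℕ+)) : ℕ) : ℤ) = _
    push_cast
    ring
  have hQ : ((S.Q : ℕ) : ℤ) ≠ 0 := by exact_mod_cast S.Q.ne_zero
  have hx' : (((((S.Q : ℕ) : ℤ) * (x₀.val : ℕ) : ℤ)) : ZMod S.N)
      = ((2 * (S.D : ℤ) ^ 2 * (k : ℤ) * (S.Q : ℤ) : ℤ) : ZMod S.N) := by
    rw [← hx]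
    push_cast [ZMod.natCast_zmod_val]
    rfl
  obtain ⟨c, hc⟩ := (ZMod.intCast_eq_intCast_iff_dvd_sub _ _ _).1 hx'
  rw [hNZ] at hc
  have hc' : ((x₀.val : ℕ) : ℤ) = 2 * (S.D : ℤ) ^ 2 * k - (S.D : ℤ) ^ 2 * (S.p₁ : ℤ) * c := by
    apply mul_left_cancel₀ hQ
    linear_combination (-1 : ℤ) * hc
  obtain ⟨hh, hlt, hmod⟩ : ∃ hh : ℕ, hh < S.Q ∧ ((hh : ℤ) : ZMod S.Q) = ((-c : ℤ) : ZMod S.Q) :=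
    ⟨((-c : ℤ) : ZMod S.Q).val, ZMod.val_lt _, by rw [Int.cast_natCast, ZMod.natCast_zmod_val]⟩
  refine ⟨hh, Finset.mem_range.2 hlt, ?_⟩
  obtain ⟨d, hd⟩ : ((S.Q : ℕ) : ℤ) ∣ (hh : ℤ) + c := by
    have h2 := (ZMod.intCast_eq_intCast_iff_dvd_sub _ _ _).1 hmod
    have h3 : (hh : ℤ) + c = -((-c) - hh) := by ring
    rw [h3, dvd_neg]
    exact h2
  rw [← ZMod.natCast_zmod_val x₀]
  unfold xkh
  have key := intCast_eq_of_sub_eq_mul (N := S.N) ((x₀.val : ℕ) : ℤ)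
    ((((S.D : ℕ) * S.D * (2 * k + S.p₁ * hh) : ℕ)) : ℤ) d (by
      rw [hNZ]
      push_cast
      linear_combination (-1 : ℤ) * hc' + ((S.D : ℤ) ^ 2 * (S.p₁ : ℤ)) * hd)
  simpa only [Int.cast_natCast] using key

/-- Distinct adjoined digits give distinct points: `h ↦ x_{k,h}` is injective on `[0, Q)`. [folklore] -/
theorem xkh_inj (k : ℕ) {h₁ h₂ : ℕ} (hh₁ : h₁ < S.Q) (hh₂ : h₂ < S.Q)
    (heq : S.xkh k h₁ = S.xkh k h₂) : h₁ = h₂ := by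
  unfold xkh at heq
  have h1 := (ZMod.natCast_eq_natCast_iff _ _ _).1 heq
  have hD : (S.D : ℕ) * S.D ≠ 0 := Nat.mul_ne_zero S.D.ne_zero S.D.ne_zero
  have h2 : 2 * k + S.p₁ * h₁ ≡ 2 * k + S.p₁ * h₂ [MOD (S.P : ℕ)] :=
    Nat.ModEq.mul_left_cancel' hD h1
  have h3 : (S.p₁ : ℕ) * h₁ ≡ S.p₁ * h₂ [MOD (S.p₁ : ℕ) * S.Q] := Nat.ModEq.add_left_cancel' _ h2
  exact Nat.ModEq.eq_of_lt_of_lt (Nat.ModEq.mul_left_cancel' S.p₁.ne_zero h3) hh₁ hh₂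

/-- The indicator of the fibre: `[Q·x₀ = 2D²Qk] = Σ_{h<Q} [x₀ = x_{k,h}]`. [folklore] -/
theorem extDiv_indicator (k : ℕ) (x₀ : ZMod S.N) :
    (if ((S.Q : ℕ) : ZMod S.N) * x₀ = ((2 * (S.D : ℤ) ^ 2 * (k : ℤ) * (S.Q : ℤ) : ℤ) : ZMod S.N)
      then (1 : ℂ) else 0)
      = ∑ hh ∈ Finset.range (S.Q : ℕ), if x₀ = S.xkh k hh then (1 : ℂ) else 0 := by
  by_cases hx : ((S.Q : ℕ) : ZMod S.N) * x₀ = ((2 * (S.D : ℤ) ^ 2 * (k : ℤ) * (S.Q : ℤ) : ℤ) : ZMod S.N)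
  · rw [if_pos hx]
    obtain ⟨h₀, hh₀, rfl⟩ := S.exists_xkh_of_Q_mul_eq k x₀ hx
    rw [Finset.sum_eq_single_of_mem h₀ hh₀ fun hh hhh hne => ?_, if_pos rfl]
    exact if_neg fun heq =>
      hne (S.xkh_inj k (Finset.mem_range.1 hh₀) (Finset.mem_range.1 hhh) heq).symm
  · rw [if_neg hx]
    symm
    refine Finset.sum_eq_zero fun hh _ => if_neg fun heq => hx ?_
    rw [heq]
    exact S.Q_mul_xkh k hh

/-! ### Register 0 after the honest (9.e)–(9.g) -/

/-- `publicHead` at the register type `ZMod N` of the shape (definitional restatement). [cite: ChenQuantumLattice2024, eq. (39)–(40) p. 36] -/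
theorem publicHead_apply (x : ZMod S.N) :
    publicHead S.D S.p₁ S.Q x
      = ∑ k ∈ Finset.range (S.p₁ : ℕ),
          if x = ((2 * (S.D : ℤ) ^ 2 * (k : ℤ) * (S.Q : ℤ) : ℤ) : ZMod S.N) then
            e (((((-((Nat.gcdB S.p₁ S.Q : ℤ) * (S.Q : ℤ) * (k : ℤ) ^ 2) : ℤ) : ZMod S.P)).val : ℚ) / S.P)
          else 0 :=
  rfl

/-- **Register `0` after the honest (9.e)–(9.g).**  Applied to `|A⟩ = Σ_{k<p₁} e(-ᾱQk²/P)|2D²Qk⟩`, the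
kernel `honestKernel` produces `Σ_{k<p₁} Σ_{h<Q} e(-ᾱQk²/P)·e(jOf(x_{k,h})²/P) |x_{k,h}⟩`,
`x_{k,h} = D²(2k + p₁h)`: `P = p₁Q` points (not `p₁`), the adjoined digit `h` uniform and uncorrelated
with the digit `j mod Q` carried by registers `1..n`. [cite: ChenQuantumLattice2024, §3.5.9 (9.e)–(9.g) pp. 37–38] -/
theorem honestKernel_headVec (x₀ : ZMod S.N) :
    ∑ x, S.honestKernel x₀ x * publicHead S.D S.p₁ S.Q x
      = ∑ k ∈ Finset.range (S.p₁ : ℕ), ∑ hh ∈ Finset.range (S.Q : ℕ),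
          if x₀ = S.xkh k hh then
            e (((((-((Nat.gcdB S.p₁ S.Q : ℤ) * (S.Q : ℤ) * (k : ℤ) ^ 2) : ℤ) : ZMod S.P)).val : ℚ) / S.P)
              * S.kickPhase (S.xkh k hh)
          else 0 := by
  have h1 : ∑ x, S.honestKernel x₀ x * publicHead S.D S.p₁ S.Q x
      = S.kickPhase x₀ * publicHead S.D S.p₁ S.Q (((S.Q : ℕ) : ZMod S.N) * x₀) := by
    simp only [honestKernel, extDivKernel, ite_mul, one_mul, zero_mul, Finset.sum_ite_eq,
      Finset.mem_univ, if_true]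
  rw [h1, publicHead_apply, Finset.mul_sum]
  refine Finset.sum_congr rfl fun k _ => ?_
  rw [show S.kickPhase x₀ * (if ((S.Q : ℕ) : ZMod S.N) * x₀
          = ((2 * (S.D : ℤ) ^ 2 * (k : ℤ) * (S.Q : ℤ) : ℤ) : ZMod S.N) then
            e (((((-((Nat.gcdB S.p₁ S.Q : ℤ) * (S.Q : ℤ) * (k : ℤ) ^ 2) : ℤ) : ZMod S.P)).val : ℚ) / S.P)
          else 0)
      = (if ((S.Q : ℕ) : ZMod S.N) * x₀ = ((2 * (S.D : ℤ) ^ 2 * (k : ℤ) * (S.Q : ℤ) : ℤ) : ZMod S.N)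
          then (1 : ℂ) else 0)
        * (e (((((-((Nat.gcdB S.p₁ S.Q : ℤ) * (S.Q : ℤ) * (k : ℤ) ^ 2) : ℤ) : ZMod S.P)).val : ℚ) / S.P)
            * S.kickPhase x₀) by
      split_ifs <;> ring,
    S.extDiv_indicator k x₀, Finset.sum_mul]
  refine Finset.sum_congr rfl fun hh _ => ?_
  split_ifs with hx
  · rw [hx, one_mul]
  · rw [zero_mul]

/-- **The honest `|φ9⟩` before the final `QFT`** is the product of the register-`0` vector of
`honestKernel_headVec` with the untouched tail `|B⟩`. [cite: ChenQuantumLattice2024, §3.5.9 (9.e)–(9.g) pp. 37–38] -/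
theorem processed_honest_cons (h : S.Admissible) (x₀ : ZMod S.N) (y' : Fin S.n → ZMod S.N) :
    S.processed S.honestKernel (Fin.cons x₀ y')
      = (∑ k ∈ Finset.range (S.p₁ : ℕ), ∑ hh ∈ Finset.range (S.Q : ℕ),
          if x₀ = S.xkh k hh then
            e (((((-((Nat.gcdB S.p₁ S.Q : ℤ) * (S.Q : ℤ) * (k : ℤ) ^ 2) : ℤ) : ZMod S.P)).val : ℚ) / S.P)
              * S.kickPhase (S.xkh k hh)
          else 0) * h.cert.tailKet y' := by
  rw [S.processed_cons h, ← S.honestKernel_headVec x₀]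
  simp_rw [S.headKet_eq_publicHead h]

/-! ### The phases at `x_{k,h}` -/

/-- The register value `x_{k,h}` is `D²·((2k + p₁h) mod P)`. [folklore] -/
theorem xkh_val (k hh : ℕ) : (S.xkh k hh).val = (S.D : ℕ) * S.D * ((2 * k + S.p₁ * hh) % (S.P : ℕ)) := by
  unfold xkh
  rw [ZMod.val_natCast]
  exact Nat.mul_mod_mul_left _ _ _

/-- Chen's read-out at `x_{k,h}`: `jOf(x_{k,h}) = (2k + p₁h)·2⁻¹ ∈ ℤ_P`. [cite: ChenQuantumLattice2024, §3.5.9 (9.g) p. 38] -/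
theorem jOf_xkh (k hh : ℕ) :
    S.jOf (S.xkh k hh) = ((2 * k + S.p₁ * hh : ℕ) : ZMod S.P) * ((S.halfP : ℕ) : ZMod S.P) := by
  unfold jOf
  rw [S.xkh_val, Nat.mul_div_cancel_left _ (Nat.pos_of_ne_zero (Nat.mul_ne_zero S.D.ne_zero S.D.ne_zero)),
    Nat.cast_mul, ZMod.natCast_mod]

/-- The kick phase at `x_{k,h}` as a character value: `e(jOf² /P) = ψ_P(((2k+p₁h)·2⁻¹)²)`. [cite: ChenQuantumLattice2024, §3.5.9 (9.g) p. 38] -/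
theorem kickPhase_xkh (k hh : ℕ) :
    S.kickPhase (S.xkh k hh)
      = ZMod.stdAddChar ((((2 * k + S.p₁ * hh : ℕ) : ZMod S.P) * ((S.halfP : ℕ) : ZMod S.P)) ^ 2) := by
  unfold kickPhase
  rw [e_val_div_eq_stdAddChar, S.jOf_xkh]

/-- The coordinate-`0` Fourier phase at `x_{k,h}`: `e(-x_{k,h}u₀/N) = ψ_P(-(2k + p₁h)·(u₀ mod P))`
(`N = D²P`, so `e(D²t/N) = e(t/P)`). [folklore] -/
theorem fourierPhase_xkh (k hh : ℕ) (u₀ : ZMod S.N) :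
    e (-((((S.xkh k hh).val * u₀.val : ℕ) : ℚ) / S.N))
      = ZMod.stdAddChar (-(((2 * k + S.p₁ * hh : ℕ) : ZMod S.P) * ((u₀.val : ℕ) : ZMod S.P))) := by
  rw [S.xkh_val]
  have hN : ((S.N : ℕ) : ℚ) = ((S.D : ℕ) : ℚ) * (S.D : ℕ) * (S.P : ℕ) := by
    rw [show (S.N : ℕ) = (S.D : ℕ) * S.D * S.P from rfl]
    push_cast
    ring
  have hD : ((S.D : ℕ) : ℚ) ≠ 0 := by exact_mod_cast S.D.ne_zero
  have h1 : -((((S.D : ℕ) * S.D * ((2 * k + S.p₁ * hh) % (S.P : ℕ)) * u₀.val : ℕ) : ℚ) / S.N)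
      = -((((((2 * k + S.p₁ * hh) % (S.P : ℕ)) * u₀.val : ℕ)) : ℚ) / (S.P : ℕ)) := by
    rw [hN, show ((((S.D : ℕ) * S.D * ((2 * k + S.p₁ * hh) % (S.P : ℕ)) * u₀.val : ℕ)) : ℚ)
        = ((S.D : ℕ) : ℚ) * (S.D : ℕ) * ((((2 * k + S.p₁ * hh) % (S.P : ℕ)) * u₀.val : ℕ) : ℚ) by
          push_cast; ring,
      mul_div_mul_left _ _ (mul_ne_zero hD hD)]
  rw [h1, e_neg_natCast_div]
  push_cast [ZMod.natCast_mod]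
  rfl

/-- The chirp coefficient of `|A⟩` as a character value. [cite: ChenQuantumLattice2024, eq. (40) p. 36] -/
theorem headCoeff_eq (k : ℕ) :
    e (((((-((Nat.gcdB S.p₁ S.Q : ℤ) * (S.Q : ℤ) * (k : ℤ) ^ 2) : ℤ) : ZMod S.P)).val : ℚ) / S.P)
      = ZMod.stdAddChar (((-((Nat.gcdB S.p₁ S.Q : ℤ) * (S.Q : ℤ) * (k : ℤ) ^ 2) : ℤ) : ZMod S.P)) :=
  e_val_div_eq_stdAddChar _ _

/-- **The total phase at `x_{k,h}` splits by CRT** into a LINEAR character of `k` modulo `p₁` and a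
quadratic character of `s = (2k + p₁h)·2⁻¹` modulo `Q`:
`e(-ᾱQk²/P)·e(ȷ̃²/P)·e(-x_{k,h}u₀/N) = ψ_{p₁}(k·(-2ᾱū)) · ψ_Q(β·s² + (-2βū)·s)` (`ū = u₀ mod p₁`, resp.
`mod Q`; `ᾱQ ≡ 1 (p₁)`, `βp₁ ≡ 1 (Q)`, `2·halfP ≡ 1`): the `p₁`-part of the chirp is cancelled by the kick,
the `Q`-part survives with unit leading coefficient `β`. [cite: ChenQuantumLattice2024, §3.5.9 (9.g)–(9.h) p. 38] -/
theorem phase_xkh_split (h : S.Admissible) (k hh : ℕ) (u₀ : ZMod S.N) :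
    e (((((-((Nat.gcdB S.p₁ S.Q : ℤ) * (S.Q : ℤ) * (k : ℤ) ^ 2) : ℤ) : ZMod S.P)).val : ℚ) / S.P)
        * S.kickPhase (S.xkh k hh) * e (-((((S.xkh k hh).val * u₀.val : ℕ) : ℚ) / S.N))
      = ZMod.stdAddChar ((k : ZMod S.p₁)
            * (-(2 * ((Nat.gcdB S.p₁ S.Q : ℤ) : ZMod S.p₁) * ((u₀.val : ℕ) : ZMod S.p₁))))
        * ZMod.stdAddChar
            (((Nat.gcdA S.p₁ S.Q : ℤ) : ZMod S.Q)
                * (((2 * k : ℕ) : ZMod S.Q) * ((S.halfP : ℕ) : ZMod S.Q)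
                    + (((S.p₁ : ℕ) : ZMod S.Q) * ((S.halfP : ℕ) : ZMod S.Q)) * (hh : ZMod S.Q)) ^ 2
              + (-(2 * ((Nat.gcdA S.p₁ S.Q : ℤ) : ZMod S.Q) * ((u₀.val : ℕ) : ZMod S.Q)))
                * (((2 * k : ℕ) : ZMod S.Q) * ((S.halfP : ℕ) : ZMod S.Q)
                    + (((S.p₁ : ℕ) : ZMod S.Q) * ((S.halfP : ℕ) : ZMod S.Q)) * (hh : ZMod S.Q))) := by
  rw [S.headCoeff_eq, S.kickPhase_xkh, S.fourierPhase_xkh, ← AddChar.map_add_eq_mul,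
    ← AddChar.map_add_eq_mul,
    stdAddChar_crt_split (S.P : ℕ) S.p₁ S.Q rfl (Nat.gcdB S.p₁ S.Q) (Nat.gcdA S.p₁ S.Q)
      (bezout_of_coprime h.cop_pQ)]
  have hα := h.gcdB_mul_Q
  have hβ := h.gcdA_mul_p₁
  have h2p := S.two_mul_halfP_cast h S.p₁_dvd_P
  have h2Q := S.two_mul_halfP_cast h S.Q_dvd_P
  congr 1
  · congr 1
    simp only [map_add, map_mul, map_pow, map_neg, map_intCast, map_natCast]
    push_cast
    rw [ZMod.natCast_self]
    linear_combination (((Nat.gcdB S.p₁ S.Q : ℤ) : ZMod S.p₁) * (k : ZMod S.p₁) ^ 2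
        * (2 * ((S.halfP : ℕ) : ZMod S.p₁) + 1)) * h2p
      - (((Nat.gcdB S.p₁ S.Q : ℤ) : ZMod S.p₁) * (k : ZMod S.p₁) ^ 2) * hα
  · congr 1
    simp only [map_add, map_mul, map_pow, map_neg, map_intCast, map_natCast]
    push_cast
    rw [ZMod.natCast_self]
    linear_combination (((Nat.gcdA S.p₁ S.Q : ℤ) : ZMod S.Q)
        * (2 * (k : ZMod S.Q) + ((S.p₁ : ℕ) : ZMod S.Q) * (hh : ZMod S.Q))
        * ((u₀.val : ℕ) : ZMod S.Q)) * h2Q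

/-! ### The head weight of the honest run -/

/-- `headWeight` at the register type `ZMod N` of the shape (definitional restatement). [cite: ChenQuantumLattice2024, §3.5.9 (9.e)–(9.h) pp. 37–38] -/
theorem headWeight_apply (K : ZMod S.N → ZMod S.N → ℂ) (u₀ : ZMod S.N) :
    headWeight S.D S.p₁ S.Q K u₀
      = ‖∑ x : ZMod S.N, (∑ x₀ : ZMod S.N, e (-(((x₀.val * u₀.val : ℕ) : ℚ) / S.N)) * K x₀ x)
          * publicHead S.D S.p₁ S.Q x‖ ^ 2 :=
  rfl

/-- The coordinate-`0` Fourier sum of the honest run, collapsed onto the points `x_{k,h}`. [cite: ChenQuantumLattice2024, §3.5.9 (9.h) p. 38] -/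
theorem fourierSum_honest (u₀ : ZMod S.N) :
    ∑ x : ZMod S.N, (∑ x₀ : ZMod S.N, e (-(((x₀.val * u₀.val : ℕ) : ℚ) / S.N)) * S.honestKernel x₀ x)
        * publicHead S.D S.p₁ S.Q x
      = ∑ k ∈ Finset.range (S.p₁ : ℕ), ∑ hh ∈ Finset.range (S.Q : ℕ),
          e (((((-((Nat.gcdB S.p₁ S.Q : ℤ) * (S.Q : ℤ) * (k : ℤ) ^ 2) : ℤ) : ZMod S.P)).val : ℚ) / S.P)
            * S.kickPhase (S.xkh k hh) * e (-((((S.xkh k hh).val * u₀.val : ℕ) : ℚ) / S.N)) := by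
  calc ∑ x : ZMod S.N, (∑ x₀ : ZMod S.N, e (-(((x₀.val * u₀.val : ℕ) : ℚ) / S.N)) * S.honestKernel x₀ x)
          * publicHead S.D S.p₁ S.Q x
      = ∑ x₀ : ZMod S.N, e (-(((x₀.val * u₀.val : ℕ) : ℚ) / S.N))
          * ∑ x : ZMod S.N, S.honestKernel x₀ x * publicHead S.D S.p₁ S.Q x := by
        simp_rw [Finset.sum_mul, Finset.mul_sum, mul_assoc]
        exact Finset.sum_comm
    _ = ∑ x₀ : ZMod S.N, ∑ k ∈ Finset.range (S.p₁ : ℕ), ∑ hh ∈ Finset.range (S.Q : ℕ),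
          if x₀ = S.xkh k hh then
            e (((((-((Nat.gcdB S.p₁ S.Q : ℤ) * (S.Q : ℤ) * (k : ℤ) ^ 2) : ℤ) : ZMod S.P)).val : ℚ) / S.P)
              * S.kickPhase (S.xkh k hh) * e (-((((S.xkh k hh).val * u₀.val : ℕ) : ℚ) / S.N))
          else 0 := by
        refine Finset.sum_congr rfl fun x₀ _ => ?_
        rw [S.honestKernel_headVec x₀, Finset.mul_sum]
        refine Finset.sum_congr rfl fun k _ => ?_
        rw [Finset.mul_sum]
        refine Finset.sum_congr rfl fun hh _ => ?_
        split_ifs with hx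
        · rw [hx]; ring
        · rw [mul_zero]
    _ = ∑ k ∈ Finset.range (S.p₁ : ℕ), ∑ hh ∈ Finset.range (S.Q : ℕ),
          e (((((-((Nat.gcdB S.p₁ S.Q : ℤ) * (S.Q : ℤ) * (k : ℤ) ^ 2) : ℤ) : ZMod S.P)).val : ℚ) / S.P)
            * S.kickPhase (S.xkh k hh) * e (-((((S.xkh k hh).val * u₀.val : ℕ) : ℚ) / S.N)) := by
        rw [Finset.sum_comm]
        refine Finset.sum_congr rfl fun k _ => ?_
        rw [Finset.sum_comm]
        refine Finset.sum_congr rfl fun hh _ => ?_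
        rw [Finset.sum_ite_eq' Finset.univ (S.xkh k hh), if_pos (Finset.mem_univ _)]

/-- **The coordinate-`0` Fourier sum of the honest run factors**: `Σ = (Σ_{k ∈ ℤ_{p₁}} ψ_{p₁}(k·(-2ᾱū)))
· (Σ_{s ∈ ℤ_Q} ψ_Q(β s² + (-2βū) s))` — a complete linear character sum modulo `p₁` times a quadratic Gauss
sum modulo `Q`. [cite: ChenQuantumLattice2024, §3.5.9 (9.h) p. 38] -/
theorem fourierSum_honest_eq_mul (h : S.Admissible) (u₀ : ZMod S.N) :
    ∑ x : ZMod S.N, (∑ x₀ : ZMod S.N, e (-(((x₀.val * u₀.val : ℕ) : ℚ) / S.N)) * S.honestKernel x₀ x)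
        * publicHead S.D S.p₁ S.Q x
      = (∑ a : ZMod S.p₁, ZMod.stdAddChar (a
            * (-(2 * ((Nat.gcdB S.p₁ S.Q : ℤ) : ZMod S.p₁) * ((u₀.val : ℕ) : ZMod S.p₁)))))
        * ∑ s : ZMod S.Q, ZMod.stdAddChar
            (((Nat.gcdA S.p₁ S.Q : ℤ) : ZMod S.Q) * s ^ 2
              + (-(2 * ((Nat.gcdA S.p₁ S.Q : ℤ) : ZMod S.Q) * ((u₀.val : ℕ) : ZMod S.Q))) * s) := by
  rw [S.fourierSum_honest u₀]
  simp_rw [S.phase_xkh_split h]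
  have hc : IsUnit (((S.p₁ : ℕ) : ZMod S.Q) * ((S.halfP : ℕ) : ZMod S.Q)) :=
    (IsUnit.of_mul_eq_one_right _ h.gcdA_mul_p₁).mul
      (IsUnit.of_mul_eq_one_right _ (S.two_mul_halfP_cast h S.Q_dvd_P))
  have inner : ∀ k : ℕ,
      ∑ hh ∈ Finset.range (S.Q : ℕ), ZMod.stdAddChar
          (((Nat.gcdA S.p₁ S.Q : ℤ) : ZMod S.Q)
              * (((2 * k : ℕ) : ZMod S.Q) * ((S.halfP : ℕ) : ZMod S.Q)
                  + (((S.p₁ : ℕ) : ZMod S.Q) * ((S.halfP : ℕ) : ZMod S.Q)) * (hh : ZMod S.Q)) ^ 2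
            + (-(2 * ((Nat.gcdA S.p₁ S.Q : ℤ) : ZMod S.Q) * ((u₀.val : ℕ) : ZMod S.Q)))
              * (((2 * k : ℕ) : ZMod S.Q) * ((S.halfP : ℕ) : ZMod S.Q)
                  + (((S.p₁ : ℕ) : ZMod S.Q) * ((S.halfP : ℕ) : ZMod S.Q)) * (hh : ZMod S.Q)))
        = ∑ s : ZMod S.Q, ZMod.stdAddChar
            (((Nat.gcdA S.p₁ S.Q : ℤ) : ZMod S.Q) * s ^ 2
              + (-(2 * ((Nat.gcdA S.p₁ S.Q : ℤ) : ZMod S.Q) * ((u₀.val : ℕ) : ZMod S.Q))) * s) := by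
    intro k
    rw [sum_range_eq_sum_zmod (S.Q : ℕ) (fun t : ZMod S.Q => ZMod.stdAddChar
          (((Nat.gcdA S.p₁ S.Q : ℤ) : ZMod S.Q)
              * (((2 * k : ℕ) : ZMod S.Q) * ((S.halfP : ℕ) : ZMod S.Q)
                  + (((S.p₁ : ℕ) : ZMod S.Q) * ((S.halfP : ℕ) : ZMod S.Q)) * t) ^ 2
            + (-(2 * ((Nat.gcdA S.p₁ S.Q : ℤ) : ZMod S.Q) * ((u₀.val : ℕ) : ZMod S.Q)))
              * (((2 * k : ℕ) : ZMod S.Q) * ((S.halfP : ℕ) : ZMod S.Q)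
                  + (((S.p₁ : ℕ) : ZMod S.Q) * ((S.halfP : ℕ) : ZMod S.Q)) * t)))]
    exact sum_affine_eq _ _ hc (fun s : ZMod S.Q => ZMod.stdAddChar
      (((Nat.gcdA S.p₁ S.Q : ℤ) : ZMod S.Q) * s ^ 2
        + (-(2 * ((Nat.gcdA S.p₁ S.Q : ℤ) : ZMod S.Q) * ((u₀.val : ℕ) : ZMod S.Q))) * s))
  simp_rw [← Finset.mul_sum, inner, ← Finset.sum_mul]
  rw [sum_range_eq_sum_zmod (S.p₁ : ℕ) (fun a : ZMod S.p₁ => ZMod.stdAddChar (a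
      * (-(2 * ((Nat.gcdB S.p₁ S.Q : ℤ) : ZMod S.p₁) * ((u₀.val : ℕ) : ZMod S.p₁)))))]

/-- **The public head weight of the honest run in closed form**: for every admissible shape and every
`u₀ ∈ ℤ_N`, `headWeight D p₁ Q honestKernel u₀ = p₁² · Q · [p₁ ∣ u₀]` (complete sum modulo `p₁`: `p₁·[p₁ ∣ u₀]`;
Gauss sum modulo `Q` with unit coefficient `β`: modulus `√Q`, Korobov 1992 Ch. I §3 Thm 3).
[cite: ChenQuantumLattice2024, §3.5.9 (9.e)–(9.h) pp. 37–38; Korobov1992, Ch. I §3 Thm 3] -/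
theorem headWeight_honest (h : S.Admissible) (u₀ : ZMod S.N) :
    headWeight S.D S.p₁ S.Q S.honestKernel u₀
      = if (S.p₁ : ℕ) ∣ u₀.val then ((S.p₁ : ℕ) : ℝ) ^ 2 * (S.Q : ℕ) else 0 := by
  haveI : NeZero (S.p₁ : ℕ) := ⟨S.p₁.ne_zero⟩
  haveI : NeZero (S.Q : ℕ) := ⟨S.Q.ne_zero⟩
  rw [S.headWeight_apply, S.fourierSum_honest_eq_mul h u₀,
    AddChar.sum_mulShift _ (ZMod.isPrimitive_stdAddChar _), ZMod.card, norm_mul, mul_pow,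
    Literature.NumberTheory.GaussSums.norm_sq_sum_stdAddChar_quadratic _ h.odd_Q _ _
      (IsUnit.of_mul_eq_one _ h.gcdA_mul_p₁)]
  have hα : IsUnit ((Nat.gcdB S.p₁ S.Q : ℤ) : ZMod S.p₁) := IsUnit.of_mul_eq_one _ h.gcdB_mul_Q
  have h2 : IsUnit (2 : ZMod S.p₁) :=
    Literature.NumberTheory.GaussSums.isUnit_two_zmod_of_odd _ h.odd_p₁
  have hiff : (-(2 * ((Nat.gcdB S.p₁ S.Q : ℤ) : ZMod S.p₁) * ((u₀.val : ℕ) : ZMod S.p₁))) = 0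
      ↔ (S.p₁ : ℕ) ∣ u₀.val := by
    rw [neg_eq_zero, (h2.mul hα).mul_right_eq_zero, ZMod.natCast_eq_zero_iff]
  by_cases hp : (S.p₁ : ℕ) ∣ u₀.val
  · rw [if_pos (hiff.2 hp), if_pos hp]
    simp
  · rw [if_neg (fun h0 => hp (hiff.1 h0)), if_neg hp]
    simp

/-! ### The output law of the honest run -/

/-- **Born weights of the honest run**: `‖QFT (processed honestKernel) (u₀ | u′)‖² = p₁²Q²·[p₁ ∣ u₀]`.
[cite: ChenQuantumLattice2024, §3.5.9 (9.h) p. 38] -/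
theorem born_weight_honest (h : S.Admissible) (u₀ : ZMod S.N) (u' : Fin S.n → ZMod S.N) :
    ‖qft (S.processed S.honestKernel) (Fin.cons u₀ u')‖ ^ 2
      = if (S.p₁ : ℕ) ∣ u₀.val then ((S.p₁ : ℕ) : ℝ) ^ 2 * ((S.Q : ℕ) : ℝ) ^ 2 else 0 := by
  rw [S.born_weight_eq h, S.headWeight_honest h]
  split_ifs <;> ring

/-- **Support of the honest output**: an outcome `(u₀ | u′)` occurs iff `p₁ ∣ u₀` — register `0` is surely a
multiple of `p₁` and NOTHING else is constrained (in particular not eq. (41)). [cite: ChenQuantumLattice2024, §3.5.9 (9.h) p. 38, eq. (41)] -/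
theorem qft_processed_honest_ne_zero_iff (h : S.Admissible) (u₀ : ZMod S.N)
    (u' : Fin S.n → ZMod S.N) :
    qft (S.processed S.honestKernel) (Fin.cons u₀ u') ≠ 0 ↔ (S.p₁ : ℕ) ∣ u₀.val := by
  have hw := S.born_weight_honest h u₀ u'
  have hp : (0 : ℝ) < ((S.p₁ : ℕ) : ℝ) := by exact_mod_cast S.p₁.pos
  have hQ : (0 : ℝ) < ((S.Q : ℕ) : ℝ) := by exact_mod_cast S.Q.pos
  constructor
  · intro hz
    by_contra hdiv
    rw [if_neg hdiv, sq_eq_zero_iff, norm_eq_zero] at hw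
    exact hz hw
  · intro hdiv hz
    rw [hz, norm_zero, if_pos hdiv] at hw
    have hpos : (0 : ℝ) < ((S.p₁ : ℕ) : ℝ) ^ 2 * ((S.Q : ℕ) : ℝ) ^ 2 :=
      mul_pos (pow_pos hp 2) (pow_pos hQ 2)
    rw [← hw] at hpos
    norm_num at hpos

/-- The honest branch occurs: `processed honestKernel ≠ 0`. [cite: ChenQuantumLattice2024, §3.5.9 p. 38] -/
theorem processed_honest_ne_zero (h : S.Admissible) : S.processed S.honestKernel ≠ 0 := by
  intro h0
  have h1 := (S.qft_processed_honest_ne_zero_iff h 0 (fun _ => 0)).2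
    (by rw [ZMod.val_zero]; exact dvd_zero _)
  rw [h0, (qft_eq_zero_iff (0 : Ket (S.n + 1) S.N)).2 rfl] at h1
  exact h1 rfl

/-- `Σ_{u₀} headWeight honestKernel u₀ = (N/p₁) · p₁² Q = N · p₁ · Q`. [cite: ChenQuantumLattice2024, §3.5.9 (9.h) p. 38] -/
theorem sum_headWeight_honest (h : S.Admissible) :
    ∑ a, headWeight S.D S.p₁ S.Q S.honestKernel a = ((S.N : ℕ) : ℝ) * (S.p₁ : ℕ) * (S.Q : ℕ) := by
  show ∑ a : ZMod S.N, headWeight S.D S.p₁ S.Q S.honestKernel a = _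
  simp_rw [S.headWeight_honest h]
  rw [← Finset.sum_filter, Finset.sum_const, nsmul_eq_mul]
  have hc : (((Finset.univ.filter fun u₀ : ZMod S.N => (S.p₁ : ℕ) ∣ u₀.val).card : ℕ) : ℝ) * S.p₁
      = S.N := by exact_mod_cast S.card_head_multiples
  rw [← hc]
  ring

/-- **The output law of the honest Step 9** (`REPAIR-CENSUS.md` T2, `STEPS.md` §4.4(d), now for all
parameters): `Pr[u = (u₀ | u′)] = p₁·[p₁ ∣ u₀] / N^{n+1}` — the final sample is UNIFORM on
`{u ∈ ℤ_N^{n+1} : p₁ ∣ u₀}`; it carries `log₂ p₁` bits about register `0` and nothing about the LWE secret.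
[cite: ChenQuantumLattice2024, §3.5.9 (9.h) p. 38] -/
theorem prob_outcome_honest (h : S.Admissible) (u₀ : ZMod S.N) (u' : Fin S.n → ZMod S.N) :
    ‖qft (S.processed S.honestKernel) (Fin.cons u₀ u')‖ ^ 2
        / ∑ u, ‖qft (S.processed S.honestKernel) u‖ ^ 2
      = (if (S.p₁ : ℕ) ∣ u₀.val then ((S.p₁ : ℕ) : ℝ) else 0) / ((S.N : ℕ) : ℝ) ^ (S.n + 1) := by
  rw [S.prob_outcome_eq h, S.sum_headWeight_honest h, S.headWeight_honest h]
  have hN : ((S.N : ℕ) : ℝ) ≠ 0 := by exact_mod_cast S.N.ne_zero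
  have hp : ((S.p₁ : ℕ) : ℝ) ≠ 0 := by exact_mod_cast S.p₁.ne_zero
  have hQ : ((S.Q : ℕ) : ℝ) ≠ 0 := by exact_mod_cast S.Q.ne_zero
  split_ifs
  · rw [div_eq_div_iff (mul_ne_zero (pow_ne_zero _ hN) (mul_ne_zero (mul_ne_zero hN hp) hQ))
      (pow_ne_zero _ hN)]
    ring
  · rw [zero_div, zero_div]

/-- **Register `0` of the honest run is surely a multiple of `p₁`**: `Pr[p₁ ∣ u₀] = 1`.
[cite: ChenQuantumLattice2024, §3.5.9 (9.h) p. 38] -/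
theorem prob_head_dvd_honest (h : S.Admissible) :
    (∑ u ∈ Finset.univ.filter (fun u : Fin (S.n + 1) → ZMod S.N => (S.p₁ : ℕ) ∣ (u 0).val),
        ‖qft (S.processed S.honestKernel) u‖ ^ 2) / ∑ u, ‖qft (S.processed S.honestKernel) u‖ ^ 2
      = 1 := by
  have hnum : ∑ u ∈ Finset.univ.filter (fun u : Fin (S.n + 1) → ZMod S.N => (S.p₁ : ℕ) ∣ (u 0).val),
        ‖qft (S.processed S.honestKernel) u‖ ^ 2 = ∑ u, ‖qft (S.processed S.honestKernel) u‖ ^ 2 := by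
    rw [Finset.sum_filter]
    refine Finset.sum_congr rfl fun u _ => ?_
    by_cases hp : (S.p₁ : ℕ) ∣ (u 0).val
    · rw [if_pos hp]
    · rw [if_neg hp]
      have hw := S.born_weight_honest h (u 0) (Fin.tail u)
      rw [Fin.cons_self_tail, if_neg hp] at hw
      rw [hw]
  have hN : (0 : ℝ) < ((S.N : ℕ) : ℝ) := by exact_mod_cast S.N.pos
  have hp : (0 : ℝ) < ((S.p₁ : ℕ) : ℝ) := by exact_mod_cast S.p₁.pos
  have hQ : (0 : ℝ) < ((S.Q : ℕ) : ℝ) := by exact_mod_cast S.Q.pos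
  rw [hnum, S.born_weight_total h, S.sum_headWeight_honest h]
  exact div_self (mul_pos (mul_pos (pow_pos hN _) hQ) (mul_pos (mul_pos hN hp) hQ)).ne'

/-- **`Pr[(41)] = 1/Q` EXACTLY for the honest Step 9** (Bezout hypothesis on `b*[1..n] mod Q`, true for
Chen's `b*` of eq. (39)): the universal bound `1/Q` of `ChenQuantumLWEBornRule.prob_eq41_le` is attained, and
Lemma 3.8's "eq. (41) with certainty" fails by exactly the factor `Q = p₂⋯p_κ`.
[cite: ChenQuantumLattice2024, Lemma 3.8 and eq. (41) p. 38] -/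
theorem prob_eq41_honest (h : S.Admissible) [DecidablePred S.eq41]
    (w : Fin S.n → ℤ) (hw : ((∑ t, w t * S.bstar (Fin.succ t) : ℤ) : ZMod S.Q) = 1) :
    (∑ u ∈ Finset.univ.filter S.eq41, ‖qft (S.processed S.honestKernel) u‖ ^ 2)
        / ∑ u, ‖qft (S.processed S.honestKernel) u‖ ^ 2
      = 1 / S.Q :=
  (S.prob_eq41_eq_inv_iff h S.honestKernel w hw).2 (S.prob_head_dvd_honest h)

end Shape

end Literature.Computability.Cryptography.Chen2024
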